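import Mathlib.Topology.PartitionOfUnity
import Mathlib.Topology.ShrinkingLemma
import Mathlib.Topology.Connected.LocallyPathConnected
import Literature.Topology.FourManifolds.SignCover
import HarnessLib

/-!
# A globally coherent side function from local side indicators (two-sidedness of a
# simply connected hypersurface piece)

Topic `Literature/Topology/FourManifolds` (consumer-side work for the fact seat
`provefact-Literature.Topology.FourManifolds.Trisection.isConnectedSum_circleProd_of_reducing_nonseparating`:
the π₁-obstruction `IsGKTrisection.not_simplyConnectedSpace_of_sideCharts` of
`ReducibleTrisectionNonSeparatingPi1Charts.lean` asks, for each compressing disc `D_q ⊆ H_q`, for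
a *side function* `sd_q = ±1`, locally constant on a punctured neighbourhood
`(O_q ∩ H_q) ∖ D_q`; this file reduces that GLOBAL datum to LOCAL side indicators).
**Everything here is proved; no new facts.**

## The statement (`exists_sideFunction_of_isLocalSide`)

Let `X` be a regular Hausdorff space, `H ⊆ X`, and `D = d(S) ⊆ X` the image of a compact,
Hausdorff, simply connected, locally path connected space `S` under a continuous injection `d`
(in the application: `S = 𝔻²`, `d` the compressing disc, `H` the handlebody `H_q`).  A **local
side indicator** for `D` inside `H` on an open set `W` (`IsLocalSide H D W s`) is a function
`s = ±1` on `(W ∩ H) ∖ D`, locally constant there relative to `H`, such that at every point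
`y ∈ D ∩ W` (a) arbitrarily small neighbourhoods `V` of `y` have *preconnected sides*
`{s = 1} ∩ (V ∩ H) ∖ D`, `{s = -1} ∩ (V ∩ H) ∖ D`, and (b) both sides accumulate at `y` — exactly
what a local flattening homeomorphism (`D` a hyperplane in a half-space or Euclidean chart of
`H`) provides.  **Theorem.**  If `D` is covered by the domains of local side indicators, there
are an open `O ⊇ D` and `sd : X → ℝ` with `sd = ±1` locally constant (rel. `H`) on
`(O ∩ H) ∖ D`, and near every point of `D ∩ W` one has `sd = κ · s` on `H ∖ D` for a constant
`κ = ±1`, for every local side indicator `(W, s)` of the family.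

## Proof (Hirsch, *Differential Topology*, Ch. 4, Thm. 4.6 "a simply connected hypersurface is
two-sided", in the covering-space form of Hatcher, Prop. 1.33, run through `SignCover.lean`)

* `IsLocalSide.exists_mul_eq`: two local side indicators at a common point `y ∈ D` have a
  locally constant *relative sign* `s_a s_b = m` near `y` (the `b`-indicator is constant on each
  preconnected `a`-side, and takes both values near `y`).
* Refinement: shrink each `W` to `W ∖ d(S ∖ P)` (`P` a path connected chart-piece of `S`), so
  that `d⁻¹(W)` is preconnected; finitely many such pieces cover `S`.
* The relative signs `M_{ij}(z)` (at `d z`) are locally constant on `d⁻¹(W_i ∩ W_j)`, symmetric,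
  and satisfy the cocycle identity.  With a partition of unity `ρ` on `S` subordinate to
  `d⁻¹(W_i)` and `i(z)` the least active index, `F(z)_j = ρ_j(z) M_{i(z) j}(z)` is
  sign-ambiguous across the nowhere dense closed set `K = ⋃ⱼ ∂{ρ_j > 0}`
  (`IsSignAmbiguous`), with local sign data `(d⁻¹ W_a, (ρ_j M_{aj})_j, M_{i(·) a})`.
* `exists_sign_resolution` (the identity of the simply connected `S` lifts through the
  two-sheeted sign cover) gives per-piece constants `κ_a` with `κ_a κ_b = M_{ab}` on overlaps,
  i.e. the corrected indicators `κ_a s_a` AGREE near `D`; `sd` is the corrected indicator of the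
  least piece of a closed shrinking containing the point.

## References

* M. W. Hirsch, *Differential Topology*, GTM 33, Springer (1976), Ch. 4, Thm. 4.6. [HirschDT1976]
* A. Hatcher, *Algebraic Topology*, CUP (2002), Prop. 1.33. [HatcherAT2002]
* T. B. Rushing, *Topological Embeddings*, Academic Press (1973), §1.7. [Rushing1973]
-/

noncomputable section

open Set Function Filter
open scoped _root_.Topology

namespace Literature.Topology.FourManifolds

variable {X : Type*} [TopologicalSpace X]

/-! ### Two topological lemmas -/

/-- Off the frontier of `s`, membership in `s` is locally constant. [folklore] -/
theorem eventually_mem_iff_of_notMem_frontier {s : Set X} {x : X} (hx : x ∉ frontier s) :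
    ∀ᶠ y in 𝓝 x, y ∈ s ↔ x ∈ s := by
  by_cases hxs : x ∈ s
  · have hxi : x ∈ interior s := by
      by_contra h
      exact hx ⟨subset_closure hxs, h⟩
    filter_upwards [isOpen_interior.mem_nhds hxi] with y hy using
      iff_of_true (interior_subset hy) hxs
  · have hxc : x ∉ closure s := fun h => hx ⟨h, fun h' => hxs (interior_subset h')⟩
    filter_upwards [isClosed_closure.isOpen_compl.mem_nhds hxc] with y hy using
      iff_of_false (fun h => hy (subset_closure h)) hxs

/-- A function which is locally constant relative to `H` at every point of a preconnected set
`P ⊆ H` is constant on `P`. [folklore] -/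
theorem eq_of_isPreconnected_of_eventuallyEq_nhdsWithin {H P : Set X} {f : X → ℝ}
    (hP : IsPreconnected P) (hPH : P ⊆ H) (hf : ∀ y ∈ P, ∀ᶠ z in 𝓝[H] y, f z = f y) {y₁ y₂ : X}
    (h₁ : y₁ ∈ P) (h₂ : y₂ ∈ P) : f y₂ = f y₁ := by
  by_contra hne
  -- the points where `f = f y₁`, resp. `f ≠ f y₁`, locally relative to `H`
  set u : Set X := {x | ∃ V, IsOpen V ∧ x ∈ V ∧ ∀ z ∈ V ∩ H, f z = f y₁} with hu_def
  set v : Set X := {x | ∃ V, IsOpen V ∧ x ∈ V ∧ ∀ z ∈ V ∩ H, f z ≠ f y₁} with hv_def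
  have hu : IsOpen u := isOpen_iff_forall_mem_open.2 fun x ⟨V, hV, hxV, hVf⟩ =>
    ⟨V, fun x' hx' => ⟨V, hV, hx', hVf⟩, hV, hxV⟩
  have hv : IsOpen v := isOpen_iff_forall_mem_open.2 fun x ⟨V, hV, hxV, hVf⟩ =>
    ⟨V, fun x' hx' => ⟨V, hV, hx', hVf⟩, hV, hxV⟩
  have hloc : ∀ y ∈ P, ∃ V, IsOpen V ∧ y ∈ V ∧ ∀ z ∈ V ∩ H, f z = f y := by
    intro y hy
    obtain ⟨t, ht, hto, hyt⟩ := eventually_nhds_iff.1 (eventually_nhdsWithin_iff.1 (hf y hy))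
    exact ⟨t, hto, hyt, fun z hz => ht z hz.1 hz.2⟩
  have hcover : P ⊆ u ∪ v := by
    intro y hy
    obtain ⟨V, hV, hyV, hVf⟩ := hloc y hy
    by_cases hfy : f y = f y₁
    · exact Or.inl ⟨V, hV, hyV, fun z hz => (hVf z hz).trans hfy⟩
    · exact Or.inr ⟨V, hV, hyV, fun z hz => fun h => hfy ((hVf z hz).symm.trans h)⟩
  have hy₁ : y₁ ∈ u := by
    obtain ⟨V, hV, hyV, hVf⟩ := hloc y₁ h₁
    exact ⟨V, hV, hyV, hVf⟩
  have hy₂ : y₂ ∈ v := by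
    obtain ⟨V, hV, hyV, hVf⟩ := hloc y₂ h₂
    exact ⟨V, hV, hyV, fun z hz h => hne ((hVf z hz).symm.trans h)⟩
  obtain ⟨x, hxP, ⟨V, -, hxV, hVf⟩, ⟨V', -, hxV', hV'f⟩⟩ :=
    hP u v hu hv hcover ⟨y₁, h₁, hy₁⟩ ⟨y₂, h₂, hy₂⟩
  exact hV'f x ⟨hxV', hPH hxP⟩ (hVf x ⟨hxV, hPH hxP⟩)

/-- A finite union of closed sets with empty interior has empty interior (a private copy of the
lemma of `ComplexTopSimplex.lean`, to keep the imports of this file light). [folklore] -/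
private theorem interior_biUnion_finset_eq_empty' {α : Type*} {A : α → Set X} (T : Finset α)
    (hc : ∀ i ∈ T, IsClosed (A i)) (hi : ∀ i ∈ T, interior (A i) = ∅) :
    interior (⋃ i ∈ T, A i) = ∅ := by
  classical
  induction T using Finset.induction_on with
  | empty => simp
  | @insert a T haT IH =>
    rw [Finset.set_biUnion_insert, interior_union_isClosed_of_interior_empty
      (hc a (Finset.mem_insert_self a T))
      (IH (fun i hi' => hc i (Finset.mem_insert_of_mem hi'))
        (fun i hi' => hi i (Finset.mem_insert_of_mem hi')))]
    exact hi a (Finset.mem_insert_self a T)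

/-! ### Local side indicators -/

/-- A **local side indicator** for `D` inside `H` on the open set `W`: a function `s = ±1` on
`(W ∩ H) ∖ D`, locally constant there relative to `H`, such that every point `y ∈ D ∩ W` has
arbitrarily small neighbourhoods `V ⊆ W` whose two *sides* `{s = ±1} ∩ ((V ∩ H) ∖ D)` are
preconnected, and both sides `{s = ±1} ∩ ((W ∩ H) ∖ D)` accumulate at `y`.  (The local picture
of a two-sided hypersurface `D ∩ H` of `H`: in a flattening chart `s` is the sign of the normal
coordinate, Hirsch 1976, Ch. 4, §4; Rushing 1973, §1.7 "locally two-sided".) [folklore] -/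
structure IsLocalSide (H D W : Set X) (s : X → ℝ) : Prop where
  /-- The domain is open. -/
  isOpen : IsOpen W
  /-- `s = ±1` on `(W ∩ H) ∖ D`. -/
  sign_eq : ∀ y ∈ (W ∩ H) \ D, s y = 1 ∨ s y = -1
  /-- `s` is locally constant relative to `H` on `(W ∩ H) ∖ D`. -/
  eventually_eq : ∀ y ∈ (W ∩ H) \ D, ∀ᶠ z in 𝓝[H] y, s z = s y
  /-- Small neighbourhoods of the points of `D ∩ W` have preconnected sides. -/
  exists_nhds : ∀ y ∈ D ∩ W, ∀ U ∈ 𝓝 y, ∃ V ∈ 𝓝 y, V ⊆ U ∩ W ∧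
    IsPreconnected {y' | y' ∈ (V ∩ H) \ D ∧ s y' = 1} ∧
    IsPreconnected {y' | y' ∈ (V ∩ H) \ D ∧ s y' = -1}
  /-- Both sides accumulate at every point of `D ∩ W`. -/
  mem_closure : ∀ y ∈ D ∩ W, ∀ σ : ℝ, σ = 1 ∨ σ = -1 →
    y ∈ closure {y' | y' ∈ (W ∩ H) \ D ∧ s y' = σ}

namespace IsLocalSide

variable {H D W W' Wa Wb : Set X} {s sa sb : X → ℝ}

/-- Restriction of a local side indicator to a smaller open set. [folklore] -/
theorem mono (h : IsLocalSide H D W s) (hW' : IsOpen W') (hsub : W' ⊆ W) :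
    IsLocalSide H D W' s where
  isOpen := hW'
  sign_eq y hy := h.sign_eq y ⟨⟨hsub hy.1.1, hy.1.2⟩, hy.2⟩
  eventually_eq y hy := h.eventually_eq y ⟨⟨hsub hy.1.1, hy.1.2⟩, hy.2⟩
  exists_nhds y hy U hU := by
    obtain ⟨V, hV, hVU, hP, hN⟩ :=
      h.exists_nhds y ⟨hy.1, hsub hy.2⟩ (U ∩ W') (inter_mem hU (hW'.mem_nhds hy.2))
    exact ⟨V, hV, fun x hx => ⟨(hVU hx).1.1, (hVU hx).1.2⟩, hP, hN⟩
  mem_closure y hy σ hσ := by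
    have h1 := h.mem_closure y ⟨hy.1, hsub hy.2⟩ σ hσ
    have h2 : y ∈ closure (W' ∩ {y' | y' ∈ (W ∩ H) \ D ∧ s y' = σ}) :=
      hW'.inter_closure ⟨hy.2, h1⟩
    refine closure_mono ?_ h2
    rintro x ⟨hxW', ⟨⟨-, hxH⟩, hxD⟩, hxs⟩
    exact ⟨⟨⟨hxW', hxH⟩, hxD⟩, hxs⟩

/-- **Relative sign of two local side indicators.**  At a common point `y ∈ D` of their domains,
two local side indicators have a constant product `s_a · s_b = m = ±1` on `H ∖ D` near `y`
("opposite sides go to opposite sides": `s_b` is constant on each of the two preconnected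
`a`-sides of a small neighbourhood, and takes both values there). [folklore] -/
theorem exists_mul_eq (ha : IsLocalSide H D Wa sa) (hb : IsLocalSide H D Wb sb) {y : X}
    (hyD : y ∈ D) (hya : y ∈ Wa) (hyb : y ∈ Wb) :
    ∃ m : ℝ, (m = 1 ∨ m = -1) ∧ ∀ᶠ y' in 𝓝 y, y' ∈ H \ D → sa y' * sb y' = m := by
  obtain ⟨V, hV, hVsub, hP, hN⟩ := ha.exists_nhds y ⟨hyD, hya⟩ Wb (hb.isOpen.mem_nhds hyb)
  -- `sb` is locally constant relative to `H` on `(V ∩ H) ∖ D`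
  have hbev : ∀ y' ∈ (V ∩ H) \ D, ∀ᶠ z in 𝓝[H] y', sb z = sb y' := fun y' hy' =>
    hb.eventually_eq y' ⟨⟨(hVsub hy'.1.1).1, hy'.1.2⟩, hy'.2⟩
  have haval : ∀ y' ∈ (V ∩ H) \ D, sa y' = 1 ∨ sa y' = -1 := fun y' hy' =>
    ha.sign_eq y' ⟨⟨(hVsub hy'.1.1).2, hy'.1.2⟩, hy'.2⟩
  have hbval : ∀ y' ∈ (V ∩ H) \ D, sb y' = 1 ∨ sb y' = -1 := fun y' hy' =>
    hb.sign_eq y' ⟨⟨(hVsub hy'.1.1).1, hy'.1.2⟩, hy'.2⟩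
  -- hence constant on each `a`-side
  have hside : ∀ y₁ ∈ (V ∩ H) \ D, ∀ y₂ ∈ (V ∩ H) \ D, sa y₁ = sa y₂ → sb y₂ = sb y₁ := by
    intro y₁ h₁ y₂ h₂ heq
    rcases haval y₁ h₁ with h1 | h1
    · exact eq_of_isPreconnected_of_eventuallyEq_nhdsWithin hP (fun y' hy' => hy'.1.1.2)
        (fun y' hy' => hbev y' hy'.1) ⟨h₁, h1⟩ ⟨h₂, heq ▸ h1⟩
    · exact eq_of_isPreconnected_of_eventuallyEq_nhdsWithin hN (fun y' hy' => hy'.1.1.2)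
        (fun y' hy' => hbev y' hy'.1) ⟨h₁, h1⟩ ⟨h₂, heq ▸ h1⟩
  -- both `b`-signs occur in `(V ∩ H) ∖ D`
  have hocc : ∀ σ : ℝ, σ = 1 ∨ σ = -1 → ∃ y' ∈ (V ∩ H) \ D, sb y' = σ := by
    intro σ hσ
    have hcl := hb.mem_closure y ⟨hyD, hyb⟩ σ hσ
    obtain ⟨y', hy'V, hy'⟩ := mem_closure_iff_nhds.1 hcl V hV
    exact ⟨y', ⟨⟨hy'V, hy'.1.1.2⟩, hy'.1.2⟩, hy'.2⟩
  obtain ⟨yp, hyp, hbp⟩ := hocc 1 (Or.inl rfl)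
  obtain ⟨ym, hym, hbm⟩ := hocc (-1) (Or.inr rfl)
  refine ⟨sa yp, haval yp hyp, ?_⟩
  filter_upwards [hV] with y' hy'V hy'HD
  have hy' : y' ∈ (V ∩ H) \ D := ⟨⟨hy'V, hy'HD.1⟩, hy'HD.2⟩
  by_cases hcase : sa y' = sa yp
  · rw [hside yp hyp y' hy' hcase.symm, hbp, mul_one, hcase]
  · -- `y'` is on the other `a`-side, together with `ym`
    have hm_side : sa ym ≠ sa yp := by
      intro h
      have := hside yp hyp ym hym h.symm
      rw [hbp, hbm] at this
      norm_num at this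
    have hneg : ∀ w ∈ (V ∩ H) \ D, sa w ≠ sa yp → sa w = -sa yp := by
      intro w hw hne
      rcases haval w hw with h1 | h1 <;> rcases haval yp hyp with h2 | h2
      · exact (hne (h1.trans h2.symm)).elim
      · rw [h1, h2]; norm_num
      · rw [h1, h2]
      · exact (hne (h1.trans h2.symm)).elim
    have h1 : sa y' = sa ym := by rw [hneg y' hy' hcase, hneg ym hym hm_side]
    rw [hside ym hym y' hy' h1.symm, hbm, h1, hneg ym hym hm_side]
    ring

end IsLocalSide

/-! ### The global side function -/

/-- **Two-sidedness of a simply connected hypersurface piece, from local side indicators.**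
Let `X` be regular Hausdorff, `H ⊆ X`, `d : S → X` a continuous injection of a compact Hausdorff,
simply connected, locally path connected space with image `D`, and `(W_a, s_a)_a` a family of
local side indicators for `D` inside `H` (`IsLocalSide`) whose domains cover `D`.  Then there are
an open set `O ⊇ D` and a **side function** `sd : X → ℝ` with `sd = ±1` and locally constant
relative to `H` on `(O ∩ H) ∖ D`, which near every point of `D ∩ W_a` equals `κ · s_a` on
`H ∖ D` for a constant `κ = ±1` (for every member `(W_a, s_a)` of the family).  This is the
covering-space proof that a simply connected two-sidedly-embedded-locally hypersurface is
two-sided (Hirsch 1976, Ch. 4, Thm. 4.6; the lifting criterion Hatcher 2002, Prop. 1.33, enters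
through `exists_sign_resolution`). [cite: HatcherAT2002, Prop. 1.33] -/
theorem exists_sideFunction_of_isLocalSide [T2Space X] [RegularSpace X]
    {S : Type*} [TopologicalSpace S] [CompactSpace S] [T2Space S] [SimplyConnectedSpace S]
    [LocallyPathConnectedSpace S]
    {H D : Set X} {d : S → X} (hd : Continuous d) (hinj : Injective d) (hD : range d = D)
    {ι : Type*} {W : ι → Set X} {s : ι → X → ℝ} (hW : ∀ a, IsLocalSide H D (W a) (s a))
    (hcov : D ⊆ ⋃ a, W a) :
    ∃ O : Set X, IsOpen O ∧ D ⊆ O ∧ ∃ sd : X → ℝ,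
      (∀ y ∈ (O ∩ H) \ D, (sd y = 1 ∨ sd y = -1) ∧ ∀ᶠ z in 𝓝[H] y, sd z = sd y) ∧
      ∀ a, ∀ y ∈ D ∩ W a, ∃ κ : ℝ, (κ = 1 ∨ κ = -1) ∧
        ∀ᶠ y' in 𝓝 y, y' ∈ H \ D → sd y' = κ * s a y' := by
  classical
  have hDc : IsCompact D := hD ▸ isCompact_range hd
  have hDcl : IsClosed D := hDc.isClosed
  have hzD : ∀ z : S, d z ∈ D := fun z => hD ▸ mem_range_self z
  /- Step 1: refine the family so that the preimages of the domains are preconnected. -/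
  choose a ha using fun z : S => mem_iUnion.1 (hcov (hzD z))
  have hP0 : ∀ z : S, ∃ P : Set S, (IsOpen P ∧ z ∈ P ∧ IsPathConnected P) ∧
      P ⊆ d ⁻¹' W (a z) := fun z =>
    (isOpen_isPathConnected_basis z).mem_iff.1
      (((hW (a z)).isOpen.preimage hd).mem_nhds (ha z))
  choose P hP hPW using hP0
  set W' : S → Set X := fun z => W (a z) ∩ (d '' (P z)ᶜ)ᶜ with hW'_def
  have hW'o : ∀ z, IsOpen (W' z) := fun z =>
    (hW (a z)).isOpen.inter
      (((hP z).1.isClosed_compl.isCompact.image hd).isClosed.isOpen_compl)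
  have hW'pre : ∀ z, d ⁻¹' W' z = P z := by
    intro z
    ext x
    simp only [hW'_def, mem_preimage, mem_inter_iff, mem_compl_iff, mem_image, not_exists,
      not_and]
    constructor
    · rintro ⟨-, h2⟩
      by_contra hx
      exact h2 x hx rfl
    · intro hx
      refine ⟨hPW z hx, fun x' hx' heq => hx' ?_⟩
      rwa [hinj heq]
  have hW'side : ∀ z, IsLocalSide H D (W' z) (s (a z)) := fun z =>
    (hW (a z)).mono (hW'o z) inter_subset_left
  /- Step 2: a finite subfamily covering `S`. -/
  obtain ⟨t, ht⟩ := isCompact_univ.elim_finite_subcover P (fun z => (hP z).1)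
    (fun z _ => mem_iUnion.2 ⟨z, (hP z).2.1⟩)
  set k : ℕ := t.card with hk
  set pt : Fin k → S := fun i => (t.equivFin.symm i : S) with hpt
  set Wf : Fin k → Set X := fun i => W' (pt i) with hWf_def
  set sf : Fin k → X → ℝ := fun i => s (a (pt i)) with hsf_def
  set U : Fin k → Set S := fun i => P (pt i) with hU_def
  have hWf : ∀ i, IsLocalSide H D (Wf i) (sf i) := fun i => hW'side (pt i)
  have hUo : ∀ i, IsOpen (U i) := fun i => (hP (pt i)).1
  have hUpre : ∀ i, IsPreconnected (U i) := fun i =>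
    (hP (pt i)).2.2.isConnected.isPreconnected
  have hUW : ∀ i, U i = d ⁻¹' Wf i := fun i => (hW'pre (pt i)).symm
  have hmemU : ∀ {i z}, z ∈ U i ↔ d z ∈ Wf i := fun {i z} => by rw [hUW i]; rfl
  have hUcov : ∀ z : S, ∃ i, z ∈ U i := by
    intro z
    obtain ⟨x, hx, hzx⟩ := mem_iUnion₂.1 (ht (mem_univ z))
    refine ⟨t.equivFin ⟨x, hx⟩, ?_⟩
    simp only [hU_def, hpt, Equiv.symm_apply_apply]
    exact hzx
  /- Step 3: the relative signs `M i j z` of the pieces at `d z`. -/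
  have hM0 : ∀ i j (z : S), d z ∈ Wf i → d z ∈ Wf j → ∃ m : ℝ, (m = 1 ∨ m = -1) ∧
      ∀ᶠ y' in 𝓝 (d z), y' ∈ H \ D → sf i y' * sf j y' = m := fun i j z hi hj =>
    (hWf i).exists_mul_eq (hWf j) (hzD z) hi hj
  let M : Fin k → Fin k → S → ℝ := fun i j z =>
    if h : d z ∈ Wf i ∧ d z ∈ Wf j then (hM0 i j z h.1 h.2).choose else 1
  have hM1 : ∀ i j z, M i j z = 1 ∨ M i j z = -1 := by
    intro i j z
    by_cases h : d z ∈ Wf i ∧ d z ∈ Wf j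
    · simp only [M, dif_pos h]
      exact (hM0 i j z h.1 h.2).choose_spec.1
    · simp only [M, dif_neg h, true_or]
  have hM2 : ∀ i j z, d z ∈ Wf i → d z ∈ Wf j →
      ∀ᶠ y' in 𝓝 (d z), y' ∈ H \ D → sf i y' * sf j y' = M i j z := by
    intro i j z hi hj
    have h : d z ∈ Wf i ∧ d z ∈ Wf j := ⟨hi, hj⟩
    simp only [M, dif_pos h]
    exact (hM0 i j z h.1 h.2).choose_spec.2
  -- witnesses: every neighbourhood of `d z` contains points of `(Wf i ∩ H) ∖ D`
  have hwit : ∀ i (z : S), d z ∈ Wf i → ∀ {p : X → Prop}, (∀ᶠ y' in 𝓝 (d z), p y') →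
      ∃ y', p y' ∧ y' ∈ (Wf i ∩ H) \ D := by
    intro i z hi p hp
    have hcl := (hWf i).mem_closure (d z) ⟨hzD z, hi⟩ 1 (Or.inl rfl)
    rw [mem_closure_iff_frequently] at hcl
    obtain ⟨y', hp', hy'⟩ := (hp.and_frequently hcl).exists
    exact ⟨y', hp', hy'.1⟩
  have hsq : ∀ i y', y' ∈ (Wf i ∩ H) \ D → sf i y' * sf i y' = 1 := by
    intro i y' hy'
    rcases (hWf i).sign_eq y' hy' with h | h <;> rw [h] <;> norm_num
  have hM_symm : ∀ i j z, d z ∈ Wf i → d z ∈ Wf j → M i j z = M j i z := by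
    intro i j z hi hj
    obtain ⟨y', ⟨h1, h2⟩, hy'⟩ := hwit i z hi ((hM2 i j z hi hj).and (hM2 j i z hj hi))
    rw [← h1 ⟨hy'.1.2, hy'.2⟩, ← h2 ⟨hy'.1.2, hy'.2⟩, mul_comm]
  have hM_cocycle : ∀ i j l z, d z ∈ Wf i → d z ∈ Wf j → d z ∈ Wf l →
      M i j z * M j l z = M i l z := by
    intro i j l z hi hj hl
    obtain ⟨y', ⟨⟨h1, h2⟩, h3⟩, hy'⟩ :=
      hwit j z hj (((hM2 i j z hi hj).and (hM2 j l z hj hl)).and (hM2 i l z hi hl))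
    have hHD : y' ∈ H \ D := ⟨hy'.1.2, hy'.2⟩
    rw [← h1 hHD, ← h2 hHD, ← h3 hHD]
    calc sf i y' * sf j y' * (sf j y' * sf l y')
        = sf i y' * sf l y' * (sf j y' * sf j y') := by ring
      _ = sf i y' * sf l y' := by rw [hsq j y' hy', mul_one]
  have hM_loc : ∀ i j (z₀ : S), d z₀ ∈ Wf i → d z₀ ∈ Wf j →
      ∀ᶠ z in 𝓝 z₀, M i j z = M i j z₀ := by
    intro i j z₀ hi hj
    have h1 : ∀ᶠ z in 𝓝 z₀, ∀ᶠ y' in 𝓝 (d z), y' ∈ H \ D → sf i y' * sf j y' = M i j z₀ :=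
      hd.continuousAt.eventually (hM2 i j z₀ hi hj).eventually_nhds
    have h2 : ∀ᶠ z in 𝓝 z₀, d z ∈ Wf i ∧ d z ∈ Wf j :=
      hd.continuousAt.eventually
        (((hWf i).isOpen.inter (hWf j).isOpen).mem_nhds ⟨hi, hj⟩)
    filter_upwards [h1, h2] with z hz1 hz2
    obtain ⟨y', ⟨hq0, hq⟩, hy'⟩ := hwit i z hz2.1 (hz1.and (hM2 i j z hz2.1 hz2.2))
    exact (hq ⟨hy'.1.2, hy'.2⟩).symm.trans (hq0 ⟨hy'.1.2, hy'.2⟩)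
  /- Step 4: a partition of unity on `S` subordinate to the pieces; least active index. -/
  obtain ⟨ρ, hρ⟩ := PartitionOfUnity.exists_isSubordinate isClosed_univ U hUo
    (fun z _ => mem_iUnion.2 (hUcov z))
  have hρsum : ∀ z, ∑ i, ρ i z = 1 := fun z => by
    rw [← finsum_eq_sum_of_fintype]; exact ρ.sum_eq_one (mem_univ z)
  have hρU : ∀ i z, ρ i z ≠ 0 → z ∈ U i := fun i z hz =>
    hρ i (subset_tsupport _ (by simpa using hz))
  let act : S → Finset (Fin k) := fun z => Finset.univ.filter fun i => 0 < ρ i z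
  have hact : ∀ z, (act z).Nonempty := by
    intro z
    obtain ⟨i, -, hi⟩ := Finset.exists_ne_zero_of_sum_ne_zero
      (by rw [hρsum z]; exact one_ne_zero)
    exact ⟨i, Finset.mem_filter.2 ⟨Finset.mem_univ _, lt_of_le_of_ne (ρ.nonneg i z) (Ne.symm hi)⟩⟩
  let idx : S → Fin k := fun z => (act z).min' (hact z)
  have hidx_mem : ∀ z, idx z ∈ act z := fun z => Finset.min'_mem _ _
  have hidx_pos : ∀ z, 0 < ρ (idx z) z := fun z => (Finset.mem_filter.1 (hidx_mem z)).2
  have hidx_U : ∀ z, z ∈ U (idx z) := fun z => hρU _ z (hidx_pos z).ne'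
  have hidx_W : ∀ z, d z ∈ Wf (idx z) := fun z => hmemU.1 (hidx_U z)
  -- the exceptional set
  set V : Fin k → Set S := fun i => {z | 0 < ρ i z} with hV_def
  have hVo : ∀ i, IsOpen (V i) := fun i => isOpen_lt continuous_const (ρ i).continuous
  set K : Set S := ⋃ i, frontier (V i) with hK_def
  have hKc : IsClosed K := isClosed_iUnion_of_finite fun i => isClosed_frontier
  have hKint : interior K = ∅ := by
    have hK' : K = ⋃ i ∈ (Finset.univ : Finset (Fin k)), frontier (V i) := by
      simp [hK_def]
    rw [hK']
    refine interior_biUnion_finset_eq_empty' _ (fun i _ => isClosed_frontier) fun i _ => ?_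
    rw [← frontier_compl]
    exact interior_frontier (hVo i).isClosed_compl
  have hidx_loc : ∀ z₀, z₀ ∉ K → ∀ᶠ z in 𝓝 z₀, idx z = idx z₀ := by
    intro z₀ hz₀
    have h1 : ∀ᶠ z in 𝓝 z₀, ∀ i, z ∈ V i ↔ z₀ ∈ V i := by
      refine eventually_all.2 fun i => eventually_mem_iff_of_notMem_frontier fun h => hz₀ ?_
      exact mem_iUnion.2 ⟨i, h⟩
    filter_upwards [h1] with z hz
    have hact_eq : act z = act z₀ := by
      ext i
      simp only [act, Finset.mem_filter, Finset.mem_univ, true_and]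
      exact hz i
    apply le_antisymm
    · exact Finset.min'_le _ _ (hact_eq ▸ hidx_mem z₀)
    · exact Finset.min'_le _ _ (hact_eq.symm ▸ hidx_mem z)
  /- Step 5: the sign-ambiguous function `F z j = ρ j z * M (idx z) j z`. -/
  have habsM : ∀ i j z, |M i j z| = 1 := by
    intro i j z
    rcases hM1 i j z with h | h <;> rw [h] <;> norm_num
  have hcomp : ∀ (i j : Fin k) (z₀ : S), z₀ ∈ U i →
      ContinuousAt (fun z => ρ j z * M i j z) z₀ := by
    intro i j z₀ hz₀
    by_cases hj : z₀ ∈ U j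
    · have hev : (fun z => ρ j z * M i j z₀) =ᶠ[𝓝 z₀] fun z => ρ j z * M i j z := by
        filter_upwards [hM_loc i j z₀ (hmemU.1 hz₀) (hmemU.1 hj)] with z hz
        rw [hz]
      exact ((ρ j).continuous.continuousAt.mul continuousAt_const).congr hev
    · have hρ0 : ρ j z₀ = 0 := by
        by_contra h
        exact hj (hρU j z₀ h)
      have hlim : Tendsto (fun z => ρ j z * M i j z) (𝓝 z₀) (𝓝 0) := by
        refine squeeze_zero_norm (fun z => ?_)
          (((ρ j).continuous.tendsto z₀).trans (by rw [hρ0]))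
        rw [norm_mul, Real.norm_eq_abs, Real.norm_eq_abs, habsM, mul_one,
          abs_of_nonneg (ρ.nonneg j z)]
      change Tendsto (fun z => ρ j z * M i j z) (𝓝 z₀) (𝓝 (ρ j z₀ * M i j z₀))
      rwa [hρ0, zero_mul]
  let F : S → Fin k → ℝ := fun z j => ρ j z * M (idx z) j z
  let g : Fin k → S → Fin k → ℝ := fun i z j => ρ j z * M i j z
  let ε : Fin k → S → ℝ := fun i z => M (idx z) i z
  have hgc : ∀ i, ContinuousOn (g i) (U i) := by
    intro i z hz
    exact (continuousAt_pi.2 fun j => hcomp i j z hz).continuousWithinAt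
  have hg0 : ∀ i, ∀ z ∈ U i, g i z ≠ 0 := by
    intro i z _ h
    have := congrFun h (idx z)
    simp only [g, Pi.zero_apply, mul_eq_zero] at this
    rcases this with h1 | h1
    · exact (hidx_pos z).ne' h1
    · rcases hM1 i (idx z) z with h2 | h2 <;> rw [h2] at h1 <;> norm_num at h1
  have hdatum : ∀ i, IsLocalSignDatum K F (U i) (g i) (ε i) := by
    intro i
    refine ⟨hUo i, hgc i, hg0 i, fun z _ => hM1 _ _ _, fun z hz => ?_⟩
    funext j
    simp only [F, g, ε, Pi.smul_apply, smul_eq_mul]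
    by_cases hj : ρ j z = 0
    · rw [hj, zero_mul, zero_mul, mul_zero]
    · have hzj : d z ∈ Wf j := hmemU.1 (hρU j z hj)
      rw [← hM_cocycle (idx z) i j z (hidx_W z) (hmemU.1 hz.1) hzj]
      ring
  have hFK : IsSignAmbiguous K F := by
    refine ⟨hKc, hKint, ⟨1, fun z => ?_⟩, ?_, fun z _ => hg0 (idx z) z (hidx_U z), fun z _ =>
      ⟨U (idx z), g (idx z), ε (idx z), hidx_U z, hdatum (idx z)⟩⟩
    · refine (pi_norm_le_iff_of_nonneg zero_le_one).2 fun j => ?_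
      simp only [F]
      rw [norm_mul, Real.norm_eq_abs, Real.norm_eq_abs, habsM, mul_one,
        abs_of_nonneg (ρ.nonneg j z)]
      exact ρ.le_one j z
    · intro z₀ hz₀
      refine ContinuousAt.continuousWithinAt (continuousAt_pi.2 fun j => ?_)
      have hev : (fun z => ρ j z * M (idx z₀) j z) =ᶠ[𝓝 z₀] fun z => F z j := by
        filter_upwards [hidx_loc z₀ hz₀] with z hz
        simp only [F, hz]
      exact (hcomp (idx z₀) j z₀ (hidx_U z₀)).congr hev
  /- Step 6: resolve the sign ambiguity over the simply connected `S`. -/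
  obtain ⟨χ, hχ1, -, hχ3⟩ := exists_sign_resolution hFK
  have hκ0 : ∀ i, ∃ κ : ℝ, (κ = 1 ∨ κ = -1) ∧ ∀ z ∈ U i \ K, χ z * ε i z = κ := fun i =>
    hχ3 (U i) (g i) (ε i) (hdatum i) (hUpre i)
  choose κ hκ1 hκ using hκ0
  have hKdense : Dense Kᶜ := interior_eq_empty_iff_dense_compl.1 hKint
  have hχsq : ∀ z, χ z * χ z = 1 := by
    intro z
    rcases hχ1 z with h | h <;> rw [h] <;> norm_num
  have hκκ : ∀ i j (z₀ : S), z₀ ∈ U i → z₀ ∈ U j → κ i * κ j = M i j z₀ := by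
    intro i j z₀ hi hj
    have hT : U i ∩ U j ∩ {z | M i j z = M i j z₀} ∈ 𝓝 z₀ :=
      inter_mem (((hUo i).inter (hUo j)).mem_nhds ⟨hi, hj⟩)
        (hM_loc i j z₀ (hmemU.1 hi) (hmemU.1 hj))
    obtain ⟨z, hzK, ⟨hzi, hzj⟩, hzM⟩ := hKdense.inter_nhds_nonempty hT
    rw [← (hzM : M i j z = M i j z₀), ← hκ i z ⟨hzi, hzK⟩, ← hκ j z ⟨hzj, hzK⟩]
    simp only [ε]
    calc χ z * M (idx z) i z * (χ z * M (idx z) j z)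
        = χ z * χ z * (M (idx z) i z * M (idx z) j z) := by ring
      _ = M i (idx z) z * M (idx z) j z := by
          rw [hχsq, one_mul, hM_symm (idx z) i z (hidx_W z) (hmemU.1 hzi)]
      _ = M i j z := hM_cocycle i (idx z) j z (hmemU.1 hzi) (hidx_W z) (hmemU.1 hzj)
  -- the corrected indicators `κ i * sf i` agree near `D`
  have hagree : ∀ i j (z : S), z ∈ U i → z ∈ U j →
      ∀ᶠ y' in 𝓝 (d z), y' ∈ H \ D → κ i * sf i y' = κ j * sf j y' := by
    intro i j z hi hj
    have h1 := hM2 i j z (hmemU.1 hi) (hmemU.1 hj)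
    have h2 : ∀ᶠ y' in 𝓝 (d z), y' ∈ Wf i := (hWf i).isOpen.mem_nhds (hmemU.1 hi)
    filter_upwards [h1, h2] with y' hy' hy'W hHD
    have hprod : sf i y' * sf j y' = κ i * κ j := by rw [hy' hHD, hκκ i j z hi hj]
    have hs1 : sf i y' * sf i y' = 1 := hsq i y' ⟨⟨hy'W, hHD.1⟩, hHD.2⟩
    have hk1 : κ j * κ j = 1 := by rcases hκ1 j with h | h <;> rw [h] <;> norm_num
    linear_combination (κ j * sf j y') * hs1 - (κ j * sf i y') * hprod - (κ i * sf i y') * hk1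
  /- Step 7: a closed shrinking of the pieces and open neighbourhoods of their images. -/
  obtain ⟨C', hC'univ, hC'cl, hC'U⟩ := exists_iUnion_eq_closed_subset hUo
    (fun z => (toFinite _ : {i | z ∈ U i}.Finite)) (by
      refine eq_univ_of_forall fun z => ?_
      obtain ⟨i, hi⟩ := hUcov z
      exact mem_iUnion.2 ⟨i, hi⟩)
  set C : Fin k → Set X := fun i => d '' C' i with hC_def
  have hCcpt : ∀ i, IsCompact (C i) := fun i => ((hC'cl i).isCompact).image hd
  have hCW : ∀ i, C i ⊆ Wf i := by
    rintro i _ ⟨z, hz, rfl⟩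
    exact hmemU.1 (hC'U i hz)
  have hWhat0 : ∀ i, ∃ What : Set X, IsOpen What ∧ C i ⊆ What ∧ closure What ⊆ Wf i :=
    fun i => (hCcpt i).exists_isOpen_closure_subset ((hWf i).isOpen.mem_nhdsSet.2 (hCW i))
  choose What hWo hCWhat hWhatW using hWhat0
  have hCcov : ∀ z : S, ∃ i, z ∈ C' i := fun z => by
    have : z ∈ ⋃ i, C' i := hC'univ ▸ mem_univ z
    exact mem_iUnion.1 this
  /- Step 8: the side function. -/
  let sd : X → ℝ := fun y' =>
    if h : (Finset.univ.filter fun i => y' ∈ What i).Nonempty then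
      κ ((Finset.univ.filter fun i => y' ∈ What i).min' h) *
        sf ((Finset.univ.filter fun i => y' ∈ What i).min' h) y'
    else 0
  have hsd : ∀ y' i₁, y' ∈ What i₁ → ∃ i₀, y' ∈ What i₀ ∧ sd y' = κ i₀ * sf i₀ y' := by
    intro y' i₁ hi₁
    have hne : (Finset.univ.filter fun i => y' ∈ What i).Nonempty :=
      ⟨i₁, Finset.mem_filter.2 ⟨Finset.mem_univ _, hi₁⟩⟩
    refine ⟨(Finset.univ.filter fun i => y' ∈ What i).min' hne, ?_, ?_⟩
    · exact (Finset.mem_filter.1 (Finset.min'_mem _ hne)).2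
    · simp only [sd, dif_pos hne]
  -- near `d z`, `sd` is the corrected indicator of any piece containing `z`
  have hkey : ∀ (z : S) (i : Fin k), z ∈ U i →
      ∀ᶠ y' in 𝓝 (d z), y' ∈ H \ D → sd y' = κ i * sf i y' := by
    intro z i hi
    obtain ⟨i₁, hi₁⟩ := hCcov z
    have hzW₁ : d z ∈ What i₁ := hCWhat i₁ ⟨z, hi₁, rfl⟩
    have E1 : ∀ᶠ y' in 𝓝 (d z), y' ∈ What i₁ := (hWo i₁).mem_nhds hzW₁
    have E2 : ∀ᶠ y' in 𝓝 (d z), ∀ j, y' ∈ What j → z ∈ U j := by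
      refine eventually_all.2 fun j => ?_
      by_cases hj : d z ∈ closure (What j)
      · exact Eventually.of_forall fun y' _ => hmemU.2 (hWhatW j hj)
      · filter_upwards [isClosed_closure.isOpen_compl.mem_nhds hj] with y' hy' hy'W
        exact (hy' (subset_closure hy'W)).elim
    have E3 : ∀ᶠ y' in 𝓝 (d z), ∀ j l, z ∈ U j → z ∈ U l →
        (y' ∈ H \ D → κ j * sf j y' = κ l * sf l y') := by
      refine eventually_all.2 fun j => eventually_all.2 fun l => ?_
      by_cases hj : z ∈ U j
      · by_cases hl : z ∈ U l
        · filter_upwards [hagree j l z hj hl] with y' hy' _ _ using hy'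
        · exact Eventually.of_forall fun y' _ hl' => (hl hl').elim
      · exact Eventually.of_forall fun y' hj' => (hj hj').elim
    filter_upwards [E1, E2, E3] with y' h1 h2 h3 hHD
    obtain ⟨i₀, hi₀, hsd₀⟩ := hsd y' i₁ h1
    rw [hsd₀]
    exact h3 i₀ i (h2 i₀ hi₀) hi hHD
  /- Step 9: the open set `O` and the conclusion. -/
  set O : Set X := ⋃ i, Wf i ∩ {y' | ∀ᶠ y'' in 𝓝 y', y'' ∈ H \ D → sd y'' = κ i * sf i y''}
    with hO_def
  have hO : IsOpen O := isOpen_iUnion fun i =>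
    (hWf i).isOpen.inter isOpen_setOf_eventually_nhds
  have hDO : D ⊆ O := by
    intro y hy
    obtain ⟨z, rfl⟩ : y ∈ range d := hD.symm ▸ hy
    exact mem_iUnion.2 ⟨idx z, hidx_W z, hkey z (idx z) (hidx_U z)⟩
  refine ⟨O, hO, hDO, sd, fun y' hy' => ?_, fun a₀ y hy => ?_⟩
  · obtain ⟨⟨hy'O, hy'H⟩, hy'D⟩ := hy'
    obtain ⟨i, hy'W, hev⟩ := mem_iUnion.1 hy'O
    have hev' : ∀ᶠ y'' in 𝓝 y', y'' ∈ H \ D → sd y'' = κ i * sf i y'' := hev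
    have h0 : sd y' = κ i * sf i y' := hev'.self_of_nhds ⟨hy'H, hy'D⟩
    have hmem : y' ∈ (Wf i ∩ H) \ D := ⟨⟨hy'W, hy'H⟩, hy'D⟩
    refine ⟨?_, ?_⟩
    · rw [h0]
      rcases hκ1 i with h | h <;> rcases (hWf i).sign_eq y' hmem with h' | h' <;>
        rw [h, h'] <;> norm_num
    · have h1 : ∀ᶠ z in 𝓝[H] y', z ∈ H := self_mem_nhdsWithin
      have h2 : ∀ᶠ z in 𝓝[H] y', z ∉ D :=
        mem_nhdsWithin_of_mem_nhds (hDcl.isOpen_compl.mem_nhds hy'D)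
      filter_upwards [h1, h2, mem_nhdsWithin_of_mem_nhds hev', (hWf i).eventually_eq y' hmem]
        with z hzH hzD hz hzs
      rw [hz ⟨hzH, hzD⟩, hzs, h0]
  · obtain ⟨hyD, hya⟩ := hy
    obtain ⟨z, rfl⟩ : y ∈ range d := hD.symm ▸ hyD
    set i := idx z
    obtain ⟨m, hm1, hm⟩ := (hWf i).exists_mul_eq (hW a₀) hyD (hidx_W z) hya
    refine ⟨κ i * m, ?_, ?_⟩
    · rcases hκ1 i with h | h <;> rcases hm1 with h' | h' <;> rw [h, h'] <;> norm_num
    · have h2 : ∀ᶠ y' in 𝓝 (d z), y' ∈ Wf i := (hWf i).isOpen.mem_nhds (hidx_W z)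
      filter_upwards [hkey z i (hidx_U z), hm, h2] with y' h1 h3 h4 hHD
      have hs1 : sf i y' * sf i y' = 1 := hsq i y' ⟨⟨h4, hHD.1⟩, hHD.2⟩
      have hmm : m * m = 1 := by rcases hm1 with h | h <;> rw [h] <;> norm_num
      have e1 := h1 hHD
      have e2 := h3 hHD
      rw [e1]
      linear_combination (-(κ i * m * sf i y')) * e2 + (κ i * m * s a₀ y') * hs1 -
        (κ i * sf i y') * hmm

end Literature.Topology.FourManifolds
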